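import Mathlib
import HarnessLib

/-!
# Crux `PrecisionLaplacian.InverseMFerromagnet` (stmt-CriticalPhenomena-4798), line `Sketch` —
# Theorem W (IM for ALL WHEELS), part 1/2 (lead c6): auxiliary algebra and the linear-algebra core

THEOREM-ONLY file (no definitions).  Theorem W (crux NOTES K6 / WHEELS.md): for every `n ≥ 3` and arbitrary
positive rim couplings `K` and spoke couplings `h`, the zero-field Ising model on the wheel `W_n = C_n + hub`
satisfies the inverse-M property.  This file carries the parts of the proof that do not mention the Gibbs
measure: (i) rotation / trace / determinant bookkeeping for products `T₀T₁⋯T_m` of `2 × 2` transfer matrices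
indexed by the spin labels `ℤˣ` (`wglue_*`), and (ii) the registered stub `helper_wheel_core`, the pure
linear-algebra heart of the theorem: if a positive definite `Σ` (hub `= Fin.last`) has entries `1`, `A/Z`, `B/Z`
and every rim site admits a column relation `X₀ Z + x₋A(k−1) + x_cA(k) + x₊A(k+1) = 2`,
`X₀A i + x₋B i (k−1) + x_cB i k + x₊B i (k+1) = δ_k[i=k]` with `δ_k < 0 < x₋, x₊` and a `k`-independent `X₀`,
then `Σ ζ_k = (2 e_hub + δ_k e_k)/Z`, so `δ_k (N⁻¹e_k) = ζ_k − 2N⁻¹e_hub` (`N = ZΣ`); all hub entries of `N⁻¹`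
share the sign of `−(X₀ − 2 N⁻¹_{hub,hub})`, hence are `≤ 0` (otherwise `pᵀBp = −s·pᵀA < 0` for the positive
vector `p = N⁻¹_{·,hub}`, contradicting `N ≻ 0`), and the far (`−2N⁻¹_{i,hub}/δ_k`) and near
(`(x_± − 2N⁻¹_{k±1,hub})/δ_k`) rim entries follow.  Part 2 (`helper_im_wheel`) feeds the three wheel stubs
(`stub_wheel_ringsum`, `stub_wheel_sl2`, `stub_wheel_column`) into this core.
-/

namespace Summit.CriticalPhenomena.Ising3DConformalLimit.Cruxes.InverseMFerromagnet.PartialCovarianceLadder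

open Finset Matrix

noncomputable section

/-! ## Rotations, traces and determinants of transfer-matrix products -/

/-- `List.ofFn (f ∘ (· + 1))` is the one-step rotation of `List.ofFn f`. [folklore] -/
theorem wglue_ofFn_add_one {α : Type*} (m : ℕ) (f : Fin (m + 1) → α) :
    List.ofFn (fun i => f (i + 1)) = (List.ofFn f).rotate 1 := by
  apply List.ext_getElem
  · simp
  · intro j h1 h2
    rw [List.getElem_ofFn, List.getElem_rotate, List.getElem_ofFn]
    congr 1
    ext
    rw [Fin.val_add]
    simp only [List.length_ofFn, Fin.val_one', Nat.add_mod_mod]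

/-- The trace of a product of matrices is invariant under one rotation of the factors. [folklore] -/
theorem wglue_trace_prod_rotate_one {ι : Type*} [Fintype ι] [DecidableEq ι] (l : List (Matrix ι ι ℝ)) :
    Matrix.trace (l.rotate 1).prod = Matrix.trace l.prod := by
  cases l with
  | nil => simp
  | cons a t =>
    rw [List.rotate_cons_succ, List.rotate_zero, List.prod_append, List.prod_singleton,
      Matrix.trace_mul_comm, List.prod_cons]

/-- The trace of the monodromy does not depend on the base point: translating the ring by `k`
leaves `Tr(T₀T₁⋯T_{m})` unchanged. [folklore] -/
theorem wglue_trace_prod_add {ι : Type*} [Fintype ι] [DecidableEq ι] (m : ℕ) (f : Fin (m + 1) → Matrix ι ι ℝ)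
    (k : Fin (m + 1)) : Matrix.trace (List.ofFn (fun i => f (i + k))).prod = Matrix.trace (List.ofFn f).prod := by
  induction k using Fin.induction generalizing f with
  | zero => simp
  | succ k ih =>
    have h1 : List.ofFn (fun i => f (i + k.succ)) = (List.ofFn fun j => f (j + Fin.castSucc k)).rotate 1 := by
      rw [← wglue_ofFn_add_one]
      congr 1
      funext i
      congr 1
      rw [← Fin.coeSucc_eq_succ]
      abel
    rw [h1, wglue_trace_prod_rotate_one, ih]

/-- The determinant of a `List.ofFn` product is the product of the determinants. [folklore] -/
theorem wglue_det_prod_ofFn {ι : Type*} [Fintype ι] [DecidableEq ι] {n : ℕ} (f : Fin n → Matrix ι ι ℝ) :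
    ((List.ofFn f).prod).det = ∏ i, (f i).det := by
  induction n with
  | zero => simp
  | succ n ih =>
    rw [List.ofFn_succ, List.prod_cons, Matrix.det_mul, ih, Fin.prod_univ_succ]

/-- The determinant of the monodromy does not depend on the base point. [folklore] -/
theorem wglue_det_prod_comp_equiv {ι : Type*} [Fintype ι] [DecidableEq ι] {n : ℕ} (f : Fin n → Matrix ι ι ℝ)
    (e : Equiv.Perm (Fin n)) :
    ((List.ofFn fun i => f (e i)).prod).det = ((List.ofFn f).prod).det := by
  rw [wglue_det_prod_ofFn, wglue_det_prod_ofFn]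
  exact Fintype.prod_equiv e _ _ fun _ => rfl

/-- A product of matrices with positive entries has positive entries. [folklore] -/
theorem wglue_prod_ofFn_pos {ι : Type*} [Fintype ι] [DecidableEq ι] [Nonempty ι] {n : ℕ}
    (f : Fin n → Matrix ι ι ℝ) (hf : ∀ i a b, 0 < f i a b) (hn : 0 < n) :
    ∀ a b, 0 < (List.ofFn f).prod a b := by
  induction n with
  | zero => exact absurd hn (lt_irrefl 0)
  | succ n ih =>
    intro a b
    rw [List.ofFn_succ, List.prod_cons]
    rcases Nat.eq_zero_or_pos n with h0 | hpos
    · subst h0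
      simp only [List.ofFn_zero, List.prod_nil, Matrix.mul_one]
      exact hf 0 a b
    · rw [Matrix.mul_apply]
      exact Finset.sum_pos (fun c _ => mul_pos (hf 0 a c) (ih (fun i => f i.succ) (fun i => hf i.succ) hpos c b))
        Finset.univ_nonempty

/-- The labels `±1` of `ℤˣ` as an explicit `Fin 2`-indexing. [folklore] -/
theorem wglue_units_equiv : ∃ e : Fin 2 ≃ ℤˣ, e 0 = 1 ∧ e 1 = -1 :=
  ⟨{ toFun := ![1, -1]
     invFun := fun u => if u = 1 then 0 else 1
     left_inv := by intro i; fin_cases i <;> simp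
     right_inv := by intro u; rcases Int.units_eq_one_or u with rfl | rfl <;> simp }, rfl, rfl⟩

/-- A `ℤˣ`-indexed determinant is the familiar `2 × 2` expression. [folklore] -/
theorem wglue_det_units (M : Matrix ℤˣ ℤˣ ℝ) : M.det = M 1 1 * M (-1) (-1) - M 1 (-1) * M (-1) 1 := by
  obtain ⟨e, he0, he1⟩ := wglue_units_equiv
  rw [← Matrix.det_submatrix_equiv_self e M, Matrix.det_fin_two]
  simp [Matrix.submatrix_apply, he0, he1]

/-- The determinant of the transfer matrix `T(K,h)_{ab} = exp(h a + K ab)` is `exp(2K) − exp(−2K)`,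
positive for `K > 0`. [folklore] -/
theorem wglue_det_transfer_pos (K' h' : ℝ) (hK : 0 < K') :
    0 < (Matrix.of fun a b : ℤˣ => Real.exp (h' * ((a : ℤ) : ℝ) + K' * (((a : ℤ) : ℝ) * ((b : ℤ) : ℝ)))).det := by
  rw [wglue_det_units]
  simp only [Matrix.of_apply, Units.val_one, Units.val_neg, Int.cast_one, Int.cast_neg, mul_one, mul_neg, neg_neg,
    ← Real.exp_add]
  ring_nf
  exact sub_pos.2 (Real.exp_lt_exp.2 (by linarith))

/-- Entries of the transfer matrix are positive. [folklore] -/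
theorem wglue_transfer_pos (K' h' : ℝ) (a b : ℤˣ) :
    0 < (Matrix.of fun a b : ℤˣ => Real.exp (h' * ((a : ℤ) : ℝ) + K' * (((a : ℤ) : ℝ) * ((b : ℤ) : ℝ)))) a b :=
  Real.exp_pos _

/-! ## The linear-algebra core (registered stub `helper_wheel_core`) -/

/-- **Core of Theorem W (pure linear algebra).**  Let `Σ ≻ 0` on `Fin (m+2)` (hub `= Fin.last`) have hub–hub
entry `1`, hub–rim entries `A i / Z`, rim–rim entries `B i j / Z` with `Z > 0`, `A > 0`, and suppose that for every rim
site `k` there is a column relation `X₀ Z + x₋A(k−1) + x_cA(k) + x₊A(k+1) = 2`,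
`X₀ A i + x₋B i (k−1) + x_c B i k + x₊ B i (k+1) = δ_k [i = k]` with `δ_k < 0 < x₋, x₊` and a `k`-independent `X₀`.
Then every off-diagonal entry of `Σ⁻¹` is `≤ 0`. [folklore] -/
theorem helper_wheel_core (m : ℕ) (hm : 2 ≤ m) (Sg : Matrix (Fin (m + 2)) (Fin (m + 2)) ℝ) (hSg : Sg.PosDef)
    (Z : ℝ) (A : Fin (m + 1) → ℝ) (B : Fin (m + 1) → Fin (m + 1) → ℝ) (hZ : 0 < Z) (hA : ∀ i, 0 < A i)
    (hBB : ∀ i j : Fin (m + 1), Sg i.castSucc j.castSucc = B i j / Z)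
    (hAl : ∀ i : Fin (m + 1), Sg (Fin.last (m + 1)) i.castSucc = A i / Z)
    (hAr : ∀ i : Fin (m + 1), Sg i.castSucc (Fin.last (m + 1)) = A i / Z)
    (hll : Sg (Fin.last (m + 1)) (Fin.last (m + 1)) = 1) (X0 : ℝ)
    (hcol : ∀ k : Fin (m + 1), ∃ xm xc xp δ : ℝ, δ < 0 ∧ 0 < xm ∧ 0 < xp ∧
      X0 * Z + xm * A (k - 1) + xc * A k + xp * A (k + 1) = 2 ∧
      (∀ i : Fin (m + 1), i ≠ k → X0 * A i + xm * B i (k - 1) + xc * B i k + xp * B i (k + 1) = 0) ∧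
      X0 * A k + xm * B k (k - 1) + xc * B k k + xp * B k (k + 1) = δ) :
    ∀ p q : Fin (m + 2), p ≠ q → Sg⁻¹ p q ≤ 0 := by
  -- the unnormalised matrix `N = Z • Σ`
  set N : Matrix (Fin (m + 2)) (Fin (m + 2)) ℝ := Z • Sg with hN
  have hNpd : N.PosDef := hSg.smul hZ
  have hNll : N (Fin.last (m + 1)) (Fin.last (m + 1)) = Z := by
    rw [hN, Matrix.smul_apply, hll, smul_eq_mul, mul_one]
  have hNBB : ∀ i j : Fin (m + 1), N i.castSucc j.castSucc = B i j := by
    intro i j; rw [hN, Matrix.smul_apply, hBB, smul_eq_mul]; field_simp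
  have hNAl : ∀ i : Fin (m + 1), N (Fin.last (m + 1)) i.castSucc = A i := by
    intro i; rw [hN, Matrix.smul_apply, hAl, smul_eq_mul]; field_simp
  have hNAr : ∀ i : Fin (m + 1), N i.castSucc (Fin.last (m + 1)) = A i := by
    intro i; rw [hN, Matrix.smul_apply, hAr, smul_eq_mul]; field_simp
  have hNdet : IsUnit N.det := (Matrix.isUnit_iff_isUnit_det N).1 hNpd.isUnit
  set P : Matrix (Fin (m + 2)) (Fin (m + 2)) ℝ := N⁻¹ with hP
  have hPN : P * N = 1 := Matrix.nonsing_inv_mul N hNdet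
  have hNP : N * P = 1 := Matrix.mul_nonsing_inv N hNdet
  have hNsymm : Nᵀ = N := by
    have h1 := hNpd.isHermitian
    rwa [Matrix.IsHermitian, Matrix.conjTranspose_eq_transpose_of_trivial] at h1
  have hPsymm : ∀ p q, P p q = P q p := by
    intro p q
    have h1 : Pᵀ = P := by rw [hP, Matrix.transpose_nonsing_inv, hNsymm]
    conv_lhs => rw [← h1]
    rfl
  have hs : 0 < P (Fin.last (m + 1)) (Fin.last (m + 1)) := hNpd.inv.diag_pos
  -- small index facts on `Fin (m+1)`, `m + 1 ≥ 3`
  have hval1 : ((1 : Fin (m + 1)) : ℕ) = 1 := by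
    rw [Fin.val_one', Nat.mod_eq_of_lt (by omega)]
  have hval2 : ((1 + 1 : Fin (m + 1)) : ℕ) = 2 := by
    rw [Fin.val_add, hval1, Nat.mod_eq_of_lt (by omega)]
  have hneb : ∀ (k b : Fin (m + 1)), (b : ℕ) ≠ 0 → k + b ≠ k := by
    intro k b hb hk
    have h1 : ((k : ℕ) + b) % (m + 1) = ((k : ℕ) + 0) % (m + 1) := by
      rw [← Fin.val_add, hk, add_zero, Nat.mod_eq_of_lt k.isLt]
    have h2 := Nat.modEq_zero_iff_dvd.1 (Nat.ModEq.add_left_cancel' (k : ℕ) h1)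
    have h3 := Nat.le_of_dvd (Nat.pos_of_ne_zero hb) h2
    exact absurd b.isLt (not_lt.2 h3)
  have hne1 : ∀ k : Fin (m + 1), k + 1 ≠ k := fun k => hneb k 1 (by rw [hval1]; exact one_ne_zero)
  have hne2 : ∀ k : Fin (m + 1), k - 1 ≠ k := by
    intro k hk
    exact hne1 (k - 1) (by rw [sub_add_cancel]; exact hk.symm)
  have hne3 : ∀ k : Fin (m + 1), k - 1 ≠ k + 1 := by
    intro k hk
    refine hneb (k - 1) (1 + 1) (by rw [hval2]; exact two_ne_zero) ?_
    rw [← add_assoc, sub_add_cancel]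
    exact hk.symm
  -- the identities (⋆): for every rim site `k`, `ζ_k = 2 P e_hub + δ_k P e_k`
  have hstar : ∀ k : Fin (m + 1), ∃ xm xp δ : ℝ, δ < 0 ∧ 0 < xm ∧ 0 < xp ∧
      X0 = 2 * P (Fin.last (m + 1)) (Fin.last (m + 1)) + δ * P (Fin.last (m + 1)) k.castSucc ∧
      (∀ i : Fin (m + 1), i ≠ k - 1 → i ≠ k → i ≠ k + 1 →
        (0 : ℝ) = 2 * P i.castSucc (Fin.last (m + 1)) + δ * P i.castSucc k.castSucc) ∧
      xp = 2 * P (k + 1).castSucc (Fin.last (m + 1)) + δ * P (k + 1).castSucc k.castSucc ∧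
      xm = 2 * P (k - 1).castSucc (Fin.last (m + 1)) + δ * P (k - 1).castSucc k.castSucc := by
    intro k
    obtain ⟨xm, xc, xp, δ, hδ, hxm, hxp, hR1, hR2, hR3⟩ := hcol k
    refine ⟨xm, xp, δ, hδ, hxm, hxp, ?_⟩
    let ζ : Fin (m + 2) → ℝ := X0 • Pi.single (Fin.last (m + 1)) 1 + xm • Pi.single (k - 1).castSucc 1
      + xc • Pi.single k.castSucc 1 + xp • Pi.single (k + 1).castSucc 1
    have hζL : ζ (Fin.last (m + 1)) = X0 := by
      simp [ζ, (Fin.castSucc_lt_last _).ne']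
    have hζi : ∀ i : Fin (m + 1), ζ i.castSucc
        = (if i = k - 1 then xm else 0) + (if i = k then xc else 0) + (if i = k + 1 then xp else 0) := by
      intro i
      simp only [ζ, Pi.add_apply, Pi.smul_apply, smul_eq_mul, Pi.single_apply, Fin.castSucc_inj,
        (Fin.castSucc_lt_last i).ne, if_false, mul_zero, zero_add, mul_ite, mul_one]
    have hmv : ∀ p, (N *ᵥ ζ) p
        = X0 * N p (Fin.last (m + 1)) + xm * N p (k - 1).castSucc + xc * N p k.castSucc + xp * N p (k + 1).castSucc := by
      intro p
      simp only [ζ, Matrix.mulVec_add, Matrix.mulVec_smul, Matrix.mulVec_single_one, Pi.add_apply,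
        Pi.smul_apply, Matrix.col_apply, smul_eq_mul]
    have hNζ : N *ᵥ ζ = (2 : ℝ) • Pi.single (Fin.last (m + 1)) 1 + δ • Pi.single k.castSucc 1 := by
      funext p
      rw [hmv]
      refine Fin.lastCases ?_ (fun i => ?_) p
      · simp only [Pi.add_apply, Pi.smul_apply, smul_eq_mul, Pi.single_eq_same,
          Pi.single_eq_of_ne (Fin.castSucc_lt_last k).ne', mul_zero, add_zero, mul_one]
        rw [hNll, hNAl, hNAl, hNAl]
        exact hR1
      · simp only [Pi.add_apply, Pi.smul_apply, smul_eq_mul, Pi.single_apply, Fin.castSucc_inj,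
          (Fin.castSucc_lt_last i).ne, if_false, mul_zero, zero_add, mul_ite, mul_one]
        rw [hNAr, hNBB, hNBB, hNBB]
        by_cases hik : i = k
        · subst hik; rw [if_pos rfl]; exact hR3
        · rw [if_neg hik]; exact hR2 i hik
    have hζ : ζ = (2 : ℝ) • (P *ᵥ Pi.single (Fin.last (m + 1)) 1) + δ • (P *ᵥ Pi.single k.castSucc 1) := by
      have h1 : P *ᵥ (N *ᵥ ζ) = ζ := by rw [Matrix.mulVec_mulVec, hPN, Matrix.one_mulVec]
      rw [← h1, hNζ, Matrix.mulVec_add, Matrix.mulVec_smul, Matrix.mulVec_smul]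
    have hζp : ∀ p, ζ p = 2 * P p (Fin.last (m + 1)) + δ * P p k.castSucc := by
      intro p
      have h1 := congrFun hζ p
      simpa only [Pi.add_apply, Pi.smul_apply, smul_eq_mul, Matrix.mulVec_single_one, Matrix.col_apply] using h1
    refine ⟨?_, ?_, ?_, ?_⟩
    · rw [← hζL]; exact hζp (Fin.last (m + 1))
    · intro i h1 h2 h3
      have h4 := hζp i.castSucc
      rwa [hζi, if_neg h1, if_neg h2, if_neg h3, add_zero, add_zero] at h4
    · have h4 := hζp (k + 1).castSucc
      rwa [hζi, if_neg (hne3 k).symm, if_neg (hne1 k), if_pos rfl, zero_add, zero_add] at h4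
    · have h4 := hζp (k - 1).castSucc
      rwa [hζi, if_pos rfl, if_neg (hne2 k), if_neg (hne3 k), add_zero, add_zero] at h4
  -- all hub entries of `P` are `≤ 0`
  have hhub : ∀ k : Fin (m + 1), P (Fin.last (m + 1)) k.castSucc ≤ 0 := by
    by_contra hcon
    push Not at hcon
    obtain ⟨k0, hk0⟩ := hcon
    obtain ⟨xm0, xp0, δ0, hδ0, -, -, hE1, -, -, -⟩ := hstar k0
    have hneg : X0 - 2 * P (Fin.last (m + 1)) (Fin.last (m + 1)) < 0 := by
      rw [show X0 - 2 * P (Fin.last (m + 1)) (Fin.last (m + 1)) = δ0 * P (Fin.last (m + 1)) k0.castSucc by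
        linarith]
      exact mul_neg_of_neg_of_pos hδ0 hk0
    have hall : ∀ k : Fin (m + 1), 0 < P (Fin.last (m + 1)) k.castSucc := by
      intro k
      obtain ⟨xm, xp, δ, hδ, -, -, hE1k, -, -, -⟩ := hstar k
      by_contra hle
      push Not at hle
      have h1 : 0 ≤ δ * P (Fin.last (m + 1)) k.castSucc := mul_nonneg_of_nonpos_of_nonpos hδ.le hle
      linarith
    have hrow : ∀ i : Fin (m + 1),
        (∑ j, B i j * P j.castSucc (Fin.last (m + 1))) + A i * P (Fin.last (m + 1)) (Fin.last (m + 1)) = 0 := by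
      intro i
      have h1 := congrFun (congrFun hNP i.castSucc) (Fin.last (m + 1))
      rw [Matrix.mul_apply, Matrix.one_apply_ne (Fin.castSucc_lt_last i).ne, Fin.sum_univ_castSucc, hNAr] at h1
      simp only [hNBB] at h1
      exact h1
    let v : Fin (m + 2) → ℝ := fun q => Fin.lastCases (0 : ℝ) (fun j => P j.castSucc (Fin.last (m + 1))) q
    have hvL : v (Fin.last (m + 1)) = 0 := by simp [v]
    have hvi : ∀ j : Fin (m + 1), v j.castSucc = P j.castSucc (Fin.last (m + 1)) := by
      intro j; simp [v]
    have hv : v ≠ 0 := by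
      intro hv0
      have h1 := congrFun hv0 (0 : Fin (m + 1)).castSucc
      rw [hvi, Pi.zero_apply, hPsymm] at h1
      exact (hall 0).ne' h1
    have hNv : ∀ i : Fin (m + 1), (N *ᵥ v) i.castSucc = -(A i * P (Fin.last (m + 1)) (Fin.last (m + 1))) := by
      intro i
      rw [Matrix.mulVec, dotProduct, Fin.sum_univ_castSucc, hvL, mul_zero, add_zero]
      simp only [hvi, hNBB]
      linarith [hrow i]
    have hquad : star v ⬝ᵥ (N *ᵥ v)
        = -(P (Fin.last (m + 1)) (Fin.last (m + 1)) * ∑ i, A i * P i.castSucc (Fin.last (m + 1))) := by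
      rw [star_trivial, dotProduct, Fin.sum_univ_castSucc, hvL, zero_mul, add_zero]
      simp only [hvi, hNv, Finset.mul_sum]
      rw [← Finset.sum_neg_distrib]
      refine Finset.sum_congr rfl fun i _ => ?_
      ring
    have hpos : 0 < star v ⬝ᵥ (N *ᵥ v) := hNpd.dotProduct_mulVec_pos hv
    rw [hquad] at hpos
    have h2 : 0 < P (Fin.last (m + 1)) (Fin.last (m + 1)) * ∑ i, A i * P i.castSucc (Fin.last (m + 1)) :=
      mul_pos hs (Finset.sum_pos (fun i _ => mul_pos (hA i) (by rw [hPsymm]; exact hall i)) Finset.univ_nonempty)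
    linarith
  -- every off-diagonal entry of `P` is `≤ 0`
  have hP_le : ∀ p q : Fin (m + 2), p ≠ q → P p q ≤ 0 := by
    intro p q
    refine Fin.lastCases ?_ (fun i => ?_) p
    · refine Fin.lastCases (fun h0 => absurd rfl h0) (fun j _ => hhub j) q
    · refine Fin.lastCases (fun _ => ?_) (fun j hij => ?_) q
      · rw [hPsymm]; exact hhub i
      · have hij' : i ≠ j := fun h0 => hij (by rw [h0])
        obtain ⟨xm, xp, δ, hδ, hxm, hxp, -, hE2, hE3, hE4⟩ := hstar j
        by_cases h1 : i = j + 1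
        · subst h1
          have h5 : 0 < δ * P (j + 1).castSucc j.castSucc := by
            linarith [hhub (j + 1), hPsymm (j + 1).castSucc (Fin.last (m + 1))]
          by_contra hle
          push Not at hle
          linarith [mul_nonpos_of_nonpos_of_nonneg hδ.le hle.le]
        · by_cases h2 : i = j - 1
          · subst h2
            have h5 : 0 < δ * P (j - 1).castSucc j.castSucc := by
              linarith [hhub (j - 1), hPsymm (j - 1).castSucc (Fin.last (m + 1))]
            by_contra hle
            push Not at hle
            linarith [mul_nonpos_of_nonpos_of_nonneg hδ.le hle.le]
          · have h5 : 0 ≤ δ * P i.castSucc j.castSucc := by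
              linarith [hhub i, hE2 i h2 hij' h1, hPsymm i.castSucc (Fin.last (m + 1))]
            by_contra hle
            push Not at hle
            linarith [mul_neg_of_neg_of_pos hδ hle]
  -- `Σ⁻¹ = Z • P`
  have hSginv : Sg⁻¹ = Z • P := by
    refine Matrix.inv_eq_left_inv ?_
    rw [Matrix.smul_mul, ← Matrix.mul_smul, ← hN, hPN]
  intro p q hpq
  rw [hSginv, Matrix.smul_apply, smul_eq_mul]
  exact mul_nonpos_of_nonneg_of_nonpos hZ.le (hP_le p q hpq)


end

end Summit.CriticalPhenomena.Ising3DConformalLimit.Cruxes.InverseMFerromagnet.PartialCovarianceLadder
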